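import Mathlib
import Literature.Analysis.UnboundedOperators.ConjugateOperatorRegularity
import HarnessLib
import Summits.AtomisticToContinuum.FouriersLaw.Theorems.EmbeddedDrudeMourreMourreDissolutionLAPExpUnitaryRegularity

/-!
# Stub `stub_mourreThresholdLAP` — Mourre LAP infrastructure 13: the bounded calculus `∫ ĝ(τ) e^{iτB} dτ` stays in `C¹ ∩ 𝒞^{1,1}`

Item `stmt-AtomisticToContinuum-12594` (crux `MourreDissolution` of route `EmbeddedDrudeMourre`,
sub-problem `FouriersLaw`), line `separable-vertex-faddeev-pair-sector`, stub S6
`stub_mourreThresholdLAP` (Mourre's limiting absorption principle; NOT in the tree). Third step of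
L3 of the proof map (ABG Thm 6.2.5 by route (b)), over `…LAPExpUnitaryRegularity`: for a bounded
self-adjoint `B ∈ C¹(A; H) ∩ 𝒞^{1,1}(A; H)` and a Schwartz symbol `g`, the operator
`expCalculus B g = ∫ 𝓕g(τ) e^{iτB} dτ ∈ B(H)` (Bochner integral in operator norm; `= g(B/2π)`)

* §1 is well defined, with `(∫ 𝓕g e^{iτB}) f = ∫ 𝓕g(τ) e^{iτB} f dτ`, matrix elements
  `⟪v, g(B/2π) v⟫ = ∫ 𝓕g(τ) ⟪v, e^{iτB} v⟫ dτ`, and `𝒲(x)`, `[𝒲(x) - 1]²` pass under the integral;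
* §2 is of class `𝒞^{1,1}(A; H)`: `‖[𝒲(x)-1]² g(B/2π)‖/x² ≤ M₁ ‖[𝒲(x)-1]² B‖/x² + 2M₂‖[B,iA]‖²` with
  the moments `M_k = ∫ |τ|^k |𝓕g(τ)| dτ` of the Schwartz function `𝓕g`;
* §3 is of class `C¹(A; H)` with `[g(B/2π), iA] = ∫ 𝓕g(τ) [e^{iτB}, iA] dτ` (differentiation under
  the integral sign, dominated by the Lipschitz bound `|τ| |x| ‖[B, iA]‖`) and
  `‖[g(B/2π), iA]‖ ≤ M₁ ‖[B, iA]‖` (headline `expCalculus_regular_of_regular`).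
-/

noncomputable section

open MeasureTheory Complex Filter Topology Set
open scoped InnerProductSpace ComplexConjugate SchwartzMap FourierTransform ENNReal NNReal

namespace Summit.AtomisticToContinuum.FouriersLaw.Theorems.MourreDissolution

open Literature.Analysis.UnboundedOperators
open Literature.Analysis.UnboundedOperators.UnitaryRep

variable {H : Type*} [NormedAddCommGroup H] [InnerProductSpace ℂ H] [CompleteSpace H]

/-! ## §1. The operator `∫ 𝓕g(τ) e^{iτB} dτ` -/

/-- **The bounded smooth functional calculus through the unitary group of a bounded operator**:
`expCalculus B g = ∫ 𝓕g(τ) e^{iτB} dτ ∈ B(H)` (Bochner integral in operator norm; by Fourier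
inversion `∫ 𝓕g(τ) e^{iτb} dτ = g(b/2π)` this is `g(B/2π)`, the bounded analogue of the tree's
`fourierCalculus U g = g(H/2π)`). [folklore] -/
def expCalculus (B : H →L[ℂ] H) (g : 𝓢(ℝ, ℂ)) : H →L[ℂ] H :=
  ∫ τ, (𝓕 g : 𝓢(ℝ, ℂ)) τ • expI B τ

/-- A continuous operator family of norm `≤ 1` against a Schwartz weight is integrable. [folklore] -/
theorem integrable_schwartz_smul_of_norm_le {Φ : ℝ → H →L[ℂ] H} (hΦ : Continuous Φ) {C : ℝ}
    (hC : ∀ τ, ‖Φ τ‖ ≤ C) (k : 𝓢(ℝ, ℂ)) : Integrable fun τ : ℝ => k τ • Φ τ := by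
  refine ((k.integrable.norm).mul_const C).mono' (k.continuous.smul hΦ).aestronglyMeasurable
    (ae_of_all _ fun τ => ?_)
  rw [norm_smul]
  gcongr
  exact hC τ

/-- The integrand `𝓕g(τ) e^{iτB}` is integrable in operator norm (self-adjoint `B`). [folklore] -/
theorem integrable_fourier_smul_expI {B : H →L[ℂ] H} (hB : IsSelfAdjoint B) (g : 𝓢(ℝ, ℂ)) :
    Integrable fun τ : ℝ => (𝓕 g : 𝓢(ℝ, ℂ)) τ • expI B τ :=
  integrable_schwartz_smul_of_norm_le (continuous_expI B) (norm_expI_le_one hB) _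

/-- `(∫ 𝓕g(τ) e^{iτB} dτ) f = ∫ 𝓕g(τ) e^{iτB} f dτ`. [folklore] -/
theorem expCalculus_apply {B : H →L[ℂ] H} (hB : IsSelfAdjoint B) (g : 𝓢(ℝ, ℂ)) (f : H) :
    expCalculus B g f = ∫ τ, (𝓕 g : 𝓢(ℝ, ℂ)) τ • expI B τ f := by
  rw [expCalculus, ContinuousLinearMap.integral_apply (integrable_fourier_smul_expI hB g)]
  rfl

/-- **Matrix elements**: `⟪v, g(B/2π) w⟫ = ∫ 𝓕g(τ) ⟪v, e^{iτB} w⟫ dτ`. [folklore] -/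
theorem inner_expCalculus {B : H →L[ℂ] H} (hB : IsSelfAdjoint B) (g : 𝓢(ℝ, ℂ)) (v w : H) :
    ⟪v, expCalculus B g w⟫_ℂ = ∫ τ, (𝓕 g : 𝓢(ℝ, ℂ)) τ * ⟪v, expI B τ w⟫_ℂ := by
  have hint : Integrable fun τ : ℝ => (𝓕 g : 𝓢(ℝ, ℂ)) τ • expI B τ w := by
    have := (ContinuousLinearMap.apply ℂ H w).integrable_comp (integrable_fourier_smul_expI hB g)
    simpa using this
  rw [expCalculus_apply hB, ← integral_inner hint]
  simp_rw [inner_smul_right]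

/-- `‖g(B/2π)‖ ≤ ∫ |𝓕g|`. [folklore] -/
theorem norm_expCalculus_le {B : H →L[ℂ] H} (hB : IsSelfAdjoint B) (g : 𝓢(ℝ, ℂ)) :
    ‖expCalculus B g‖ ≤ ∫ τ, ‖(𝓕 g : 𝓢(ℝ, ℂ)) τ‖ := by
  refine (norm_integral_le_integral_norm _).trans (integral_mono_of_nonneg
    (ae_of_all _ fun τ => norm_nonneg _) (𝓕 g : 𝓢(ℝ, ℂ)).integrable.norm
    (ae_of_all _ fun τ => ?_))
  simp only
  rw [norm_smul]
  exact mul_le_of_le_one_right (norm_nonneg _) (norm_expI_le_one hB τ)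

/-- **`𝒲(x)` passes under operator-valued integrals** (it is a continuous linear map of `B(H)`).
[folklore] -/
theorem conjAut_integral (A : OneParameterUnitaryGroup H) (x : ℝ) {Φ : ℝ → H →L[ℂ] H}
    (hΦ : Integrable Φ) : A.conjAut x (∫ τ, Φ τ) = ∫ τ, A.conjAut x (Φ τ) := by
  have := (ContinuousLinearMap.mulLeftRight ℂ (H →L[ℂ] H) (A.appReal (-x))
    (A.appReal x)).integral_comp_comm hΦ
  simp only [ContinuousLinearMap.mulLeftRight_apply] at this
  simp only [conjAut]
  exact this.symm

/-- `[𝒲(x) - 1]²` passes under operator-valued integrals. [folklore] -/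
theorem secondDifference_integral (A : OneParameterUnitaryGroup H) (x : ℝ) {Φ : ℝ → H →L[ℂ] H}
    (hΦ : Integrable Φ) :
    A.secondDifference x (∫ τ, Φ τ) = ∫ τ, A.secondDifference x (Φ τ) := by
  have h1 : Integrable fun τ => A.conjAut (2 * x) (Φ τ) :=
    (ContinuousLinearMap.mulLeftRight ℂ (H →L[ℂ] H) (A.appReal (-(2 * x)))
      (A.appReal (2 * x))).integrable_comp hΦ
  have h2 : Integrable fun τ => (2 : ℂ) • A.conjAut x (Φ τ) :=
    ((ContinuousLinearMap.mulLeftRight ℂ (H →L[ℂ] H) (A.appReal (-x))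
      (A.appReal x)).integrable_comp hΦ).smul (2 : ℂ)
  have h12 : Integrable fun τ => A.conjAut (2 * x) (Φ τ) - (2 : ℂ) • A.conjAut x (Φ τ) :=
    h1.sub h2
  simp only [secondDifference]
  rw [integral_add h12 hΦ, integral_sub h1 h2, integral_smul, conjAut_integral A _ hΦ,
    conjAut_integral A _ hΦ]

/-- `𝒲(x)[g(B/2π)] = ∫ 𝓕g(τ) 𝒲(x)[e^{iτB}] dτ`. [folklore] -/
theorem conjAut_expCalculus (A : OneParameterUnitaryGroup H) (x : ℝ) {B : H →L[ℂ] H}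
    (hB : IsSelfAdjoint B) (g : 𝓢(ℝ, ℂ)) :
    A.conjAut x (expCalculus B g) = ∫ τ, (𝓕 g : 𝓢(ℝ, ℂ)) τ • A.conjAut x (expI B τ) := by
  rw [expCalculus, conjAut_integral A x (integrable_fourier_smul_expI hB g)]
  simp_rw [conjAut_smul_op]

/-- `[𝒲(x) - 1]² g(B/2π) = ∫ 𝓕g(τ) [𝒲(x) - 1]² e^{iτB} dτ`. [folklore] -/
theorem secondDifference_expCalculus (A : OneParameterUnitaryGroup H) (x : ℝ) {B : H →L[ℂ] H}
    (hB : IsSelfAdjoint B) (g : 𝓢(ℝ, ℂ)) :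
    A.secondDifference x (expCalculus B g) =
      ∫ τ, (𝓕 g : 𝓢(ℝ, ℂ)) τ • A.secondDifference x (expI B τ) := by
  rw [expCalculus, secondDifference_integral A x (integrable_fourier_smul_expI hB g)]
  simp_rw [secondDifference_smul_op]

/-! ## §2. `g(B/2π) ∈ 𝒞^{1,1}(A; H)` -/

/-- The moments `M_k(g) = ∫ |τ|^k |𝓕g(τ)| dτ` of the Fourier transform of the symbol. [folklore] -/
def fourierMoment (g : 𝓢(ℝ, ℂ)) (k : ℕ) : ℝ := ∫ τ, |τ| ^ k * ‖(𝓕 g : 𝓢(ℝ, ℂ)) τ‖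

/-- `τ ↦ |τ|^k |𝓕g(τ)|` is integrable. [folklore] -/
theorem integrable_fourierMoment (g : 𝓢(ℝ, ℂ)) (k : ℕ) :
    Integrable fun τ : ℝ => |τ| ^ k * ‖(𝓕 g : 𝓢(ℝ, ℂ)) τ‖ := by
  simpa [Real.norm_eq_abs] using (𝓕 g : 𝓢(ℝ, ℂ)).integrable_pow_mul volume k

/-- `0 ≤ M_k(g)`. [folklore] -/
theorem fourierMoment_nonneg (g : 𝓢(ℝ, ℂ)) (k : ℕ) : 0 ≤ fourierMoment g k :=
  integral_nonneg fun τ => by positivity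

/-- **The `𝒞^{1,1}` integrand of `g(B/2π)`**:
`‖[𝒲(x)-1]² g(B/2π)‖/x² ≤ M₁ ‖[𝒲(x)-1]² B‖/x² + 2 M₂ ‖[B, iA]‖²`. [folklore] -/
theorem secondDifference_expCalculus_div_sq_le {A : OneParameterUnitaryGroup H} {B D : H →L[ℂ] H}
    (hB : IsSelfAdjoint B) (h : A.HasCommutator B D) (g : 𝓢(ℝ, ℂ)) (x : ℝ) :
    ‖A.secondDifference x (expCalculus B g)‖ / x ^ 2 ≤
      fourierMoment g 1 * (‖A.secondDifference x B‖ / x ^ 2) + 2 * fourierMoment g 2 * ‖D‖ ^ 2 := by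
  set a : ℝ := ‖A.secondDifference x B‖ / x ^ 2 with ha
  have ha0 : 0 ≤ a := by positivity
  -- pointwise bound on the integrand, divided by `x²`
  have hpt : ∀ τ : ℝ, ‖(𝓕 g : 𝓢(ℝ, ℂ)) τ • A.secondDifference x (expI B τ)‖ / x ^ 2 ≤
      |τ| ^ 1 * ‖(𝓕 g : 𝓢(ℝ, ℂ)) τ‖ * a + |τ| ^ 2 * ‖(𝓕 g : 𝓢(ℝ, ℂ)) τ‖ * (2 * ‖D‖ ^ 2) := by
    intro τ
    rw [norm_smul, mul_div_assoc]
    have := secondDifference_expI_div_sq_le hB h x τ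
    calc ‖(𝓕 g : 𝓢(ℝ, ℂ)) τ‖ * (‖A.secondDifference x (expI B τ)‖ / x ^ 2)
        ≤ ‖(𝓕 g : 𝓢(ℝ, ℂ)) τ‖ * (|τ| * a + 2 * τ ^ 2 * ‖D‖ ^ 2) := by gcongr
      _ = |τ| ^ 1 * ‖(𝓕 g : 𝓢(ℝ, ℂ)) τ‖ * a + |τ| ^ 2 * ‖(𝓕 g : 𝓢(ℝ, ℂ)) τ‖ * (2 * ‖D‖ ^ 2) := by
          rw [← sq_abs τ]; ring
  have hint := (((integrable_fourierMoment g 1).mul_const a).add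
    ((integrable_fourierMoment g 2).mul_const (2 * ‖D‖ ^ 2)))
  rw [secondDifference_expCalculus A x hB g]
  calc ‖∫ τ, (𝓕 g : 𝓢(ℝ, ℂ)) τ • A.secondDifference x (expI B τ)‖ / x ^ 2
      ≤ (∫ τ, ‖(𝓕 g : 𝓢(ℝ, ℂ)) τ • A.secondDifference x (expI B τ)‖) / x ^ 2 := by
        gcongr
        exact norm_integral_le_integral_norm _
    _ = ∫ τ, ‖(𝓕 g : 𝓢(ℝ, ℂ)) τ • A.secondDifference x (expI B τ)‖ / x ^ 2 := by
        rw [integral_div]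
    _ ≤ ∫ τ, (|τ| ^ 1 * ‖(𝓕 g : 𝓢(ℝ, ℂ)) τ‖ * a +
          |τ| ^ 2 * ‖(𝓕 g : 𝓢(ℝ, ℂ)) τ‖ * (2 * ‖D‖ ^ 2)) := by
        refine integral_mono_of_nonneg (ae_of_all _ fun τ => by positivity) hint
          (ae_of_all _ fun τ => hpt τ)
    _ = fourierMoment g 1 * a + 2 * fourierMoment g 2 * ‖D‖ ^ 2 := by
        rw [integral_add ((integrable_fourierMoment g 1).mul_const a)
          ((integrable_fourierMoment g 2).mul_const _), integral_mul_const, integral_mul_const,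
          fourierMoment, fourierMoment]
        ring

/-- **`B ∈ C¹ ∩ 𝒞^{1,1}` self-adjoint ⇒ `g(B/2π) ∈ 𝒞^{1,1}(A; H)`** for every Schwartz `g`.
[cite: AmreinBoutetdeMonvelGeorgescu1996, Thm. 6.2.5] -/
theorem isOfClassC11_expCalculus {A : OneParameterUnitaryGroup H} {B : H →L[ℂ] H}
    (hB : IsSelfAdjoint B) (h1 : A.IsOfClassC1 B) (h11 : A.IsOfClassC11 B) (g : 𝓢(ℝ, ℂ)) :
    A.IsOfClassC11 (expCalculus B g) := by
  obtain ⟨D, hD⟩ := h1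
  exact isOfClassC11_of_le h11 (fourierMoment_nonneg g 1) (b := 2 * fourierMoment g 2 * ‖D‖ ^ 2)
    (by have := fourierMoment_nonneg g 2; positivity)
    fun x _ => secondDifference_expCalculus_div_sq_le hB hD g x

/-! ## §3. `g(B/2π) ∈ C¹(A; H)` by differentiation under the integral sign -/

/-- The commutator integrand `𝓕g(τ) [e^{iτB}, iA]` is integrable in operator norm. [folklore] -/
theorem integrable_fourier_smul_expIComm {A : OneParameterUnitaryGroup H} {B D : H →L[ℂ] H}
    (hB : IsSelfAdjoint B) (h : A.HasCommutator B D) (g : 𝓢(ℝ, ℂ)) :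
    Integrable fun τ : ℝ => (𝓕 g : 𝓢(ℝ, ℂ)) τ • expIComm B D τ := by
  refine (((integrable_fourierMoment g 1).mul_const ‖D‖)).mono'
    ((𝓕 g : 𝓢(ℝ, ℂ)).continuous.smul (continuous_expIComm hB h)).aestronglyMeasurable
    (ae_of_all _ fun τ => ?_)
  rw [norm_smul, pow_one]
  calc ‖(𝓕 g : 𝓢(ℝ, ℂ)) τ‖ * ‖expIComm B D τ‖ ≤ ‖(𝓕 g : 𝓢(ℝ, ℂ)) τ‖ * (|τ| * ‖D‖) := by
        gcongr; exact norm_expIComm_le hB h τ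
    _ = |τ| * ‖(𝓕 g : 𝓢(ℝ, ℂ)) τ‖ * ‖D‖ := by ring

/-- `𝒲(x)[e^{iτB}] - 𝒲(y)[e^{iτB}]` has norm `≤ |τ| |x - y| ‖[B, iA]‖` (group law + Lipschitz bound).
[folklore] -/
theorem norm_conjAut_expI_sub_conjAut_le {A : OneParameterUnitaryGroup H} {B D : H →L[ℂ] H}
    (hB : IsSelfAdjoint B) (h : A.HasCommutator B D) (x y τ : ℝ) :
    ‖A.conjAut x (expI B τ) - A.conjAut y (expI B τ)‖ ≤ |τ| * (|x - y| * ‖D‖) := by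
  have e : A.conjAut x (expI B τ) - A.conjAut y (expI B τ) =
      A.conjAut y (A.conjAut (x - y) (expI B τ) - expI B τ) := by
    rw [conjAut_sub_op, ← conjAut_add, add_sub_cancel]
  rw [e, norm_conjAut]
  exact norm_conjAut_expI_sub_le hB h (x - y) τ

/-- **`[g(B/2π), iA] = ∫ 𝓕g(τ) [e^{iτB}, iA] dτ`**: `B ∈ C¹(A; H)` self-adjoint implies
`g(B/2π) ∈ C¹(A; H)` (differentiation of `x ↦ ∫ 𝓕g(τ) 𝒲(x)[e^{iτB}] f dτ` under the integral
sign, dominated by the integrable Lipschitz bound `|𝓕g(τ)| |τ| ‖[B, iA]‖ ‖f‖`).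
[cite: AmreinBoutetdeMonvelGeorgescu1996, Thm. 6.2.5] -/
theorem hasCommutator_expCalculus {A : OneParameterUnitaryGroup H} {B D : H →L[ℂ] H}
    (hB : IsSelfAdjoint B) (h : A.HasCommutator B D) (g : 𝓢(ℝ, ℂ)) :
    A.HasCommutator (expCalculus B g) (∫ τ, (𝓕 g : 𝓢(ℝ, ℂ)) τ • expIComm B D τ) := by
  intro f
  set F : ℝ → ℝ → H := fun x τ => (𝓕 g : 𝓢(ℝ, ℂ)) τ • A.conjAut x (expI B τ) f with hF
  set F' : ℝ → H := fun τ => (𝓕 g : 𝓢(ℝ, ℂ)) τ • expIComm B D τ f with hF'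
  set bound : ℝ → ℝ := fun τ => |τ| ^ 1 * ‖(𝓕 g : 𝓢(ℝ, ℂ)) τ‖ * (‖D‖ * ‖f‖) with hbound
  have hF_cont : ∀ x, Continuous (F x) := fun x => by
    have hc : Continuous fun τ : ℝ => A.appReal (-x) (expI B τ (A.appReal x f)) :=
      continuous_const.clm_apply ((continuous_expI B).clm_apply continuous_const)
    exact (𝓕 g : 𝓢(ℝ, ℂ)).continuous.smul hc
  have hF_meas : ∀ᶠ x in 𝓝 (0 : ℝ), AEStronglyMeasurable (F x) volume :=
    Eventually.of_forall fun x => (hF_cont x).aestronglyMeasurable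
  have hF_int : Integrable (F 0) volume := by
    have := (ContinuousLinearMap.apply ℂ H f).integrable_comp (integrable_fourier_smul_expI hB g)
    simpa [hF] using this
  have hF'_meas : AEStronglyMeasurable F' volume :=
    ((𝓕 g : 𝓢(ℝ, ℂ)).continuous.smul
      ((continuous_expIComm hB h).clm_apply continuous_const)).aestronglyMeasurable
  have h_lip : ∀ᵐ τ ∂volume, LipschitzOnWith (Real.nnabs (bound τ)) (fun x => F x τ) Set.univ := by
    refine ae_of_all _ fun τ => LipschitzOnWith.of_dist_le_mul fun x _ y _ => ?_
    rw [dist_eq_norm, dist_eq_norm, Real.coe_nnabs, hbound]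
    simp only [hF]
    rw [← smul_sub, norm_smul, ← _root_.sub_apply,
      abs_of_nonneg (by positivity : (0 : ℝ) ≤ |τ| ^ 1 * ‖(𝓕 g : 𝓢(ℝ, ℂ)) τ‖ * (‖D‖ * ‖f‖))]
    calc ‖(𝓕 g : 𝓢(ℝ, ℂ)) τ‖ * ‖(A.conjAut x (expI B τ) - A.conjAut y (expI B τ)) f‖
        ≤ ‖(𝓕 g : 𝓢(ℝ, ℂ)) τ‖ * (|τ| * (|x - y| * ‖D‖) * ‖f‖) := by
          gcongr
          exact (ContinuousLinearMap.le_opNorm _ _).trans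
            (by gcongr; exact norm_conjAut_expI_sub_conjAut_le hB h x y τ)
      _ = |τ| ^ 1 * ‖(𝓕 g : 𝓢(ℝ, ℂ)) τ‖ * (‖D‖ * ‖f‖) * ‖x - y‖ := by
          rw [Real.norm_eq_abs, pow_one]; ring
  have bound_integrable : Integrable bound volume :=
    (integrable_fourierMoment g 1).mul_const _
  have h_diff : ∀ᵐ τ ∂volume, HasDerivAt (fun x => F x τ) (F' τ) 0 :=
    ae_of_all _ fun τ => (hasCommutator_expI h τ f).const_smul ((𝓕 g : 𝓢(ℝ, ℂ)) τ)
  have key := (hasDerivAt_integral_of_dominated_loc_of_lip (F := F) (F' := F') (x₀ := (0 : ℝ))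
    univ_mem hF_meas hF_int hF'_meas h_lip bound_integrable h_diff).2
  -- identify the integral of `F x` with `𝒲(x)[g(B/2π)] f` and that of `F'` with the commutator
  have e1 : (fun x : ℝ => ∫ τ, F x τ) = fun x => A.conjAut x (expCalculus B g) f := by
    funext x
    have hint : Integrable (fun τ : ℝ => (𝓕 g : 𝓢(ℝ, ℂ)) τ • A.conjAut x (expI B τ)) := by
      simp_rw [conjAut_expI]
      exact integrable_fourier_smul_expI (isSelfAdjoint_conjAut A x hB) g
    rw [conjAut_expCalculus A x hB g, ContinuousLinearMap.integral_apply hint]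
    rfl
  have e2 : (∫ τ, F' τ) = (∫ τ, (𝓕 g : 𝓢(ℝ, ℂ)) τ • expIComm B D τ) f := by
    rw [ContinuousLinearMap.integral_apply (integrable_fourier_smul_expIComm hB h g)]
    rfl
  rw [e1, e2] at key
  exact key

/-- `B ∈ C¹(A; H)` self-adjoint ⇒ `g(B/2π) ∈ C¹(A; H)`. [cite: AmreinBoutetdeMonvelGeorgescu1996, Thm. 6.2.5] -/
theorem isOfClassC1_expCalculus {A : OneParameterUnitaryGroup H} {B : H →L[ℂ] H}
    (hB : IsSelfAdjoint B) (h1 : A.IsOfClassC1 B) (g : 𝓢(ℝ, ℂ)) :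
    A.IsOfClassC1 (expCalculus B g) :=
  (hasCommutator_expCalculus hB h1.hasCommutator g).isOfClassC1

/-- **`‖[g(B/2π), iA]‖ ≤ M₁(g) ‖[B, iA]‖`.** [folklore] -/
theorem norm_commutatorCLM_expCalculus_le {A : OneParameterUnitaryGroup H} {B : H →L[ℂ] H}
    (hB : IsSelfAdjoint B) (h1 : A.IsOfClassC1 B) (g : 𝓢(ℝ, ℂ)) :
    ‖A.commutatorCLM (expCalculus B g)‖ ≤ fourierMoment g 1 * ‖A.commutatorCLM B‖ := by
  rw [(hasCommutator_expCalculus hB h1.hasCommutator g).commutatorCLM_eq]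
  refine (norm_integral_le_integral_norm _).trans ?_
  rw [fourierMoment, ← integral_mul_const]
  refine integral_mono_of_nonneg (ae_of_all _ fun τ => norm_nonneg _)
    ((integrable_fourierMoment g 1).mul_const _) (ae_of_all _ fun τ => ?_)
  simp only
  rw [norm_smul, pow_one]
  calc ‖(𝓕 g : 𝓢(ℝ, ℂ)) τ‖ * ‖expIComm B (A.commutatorCLM B) τ‖
      ≤ ‖(𝓕 g : 𝓢(ℝ, ℂ)) τ‖ * (|τ| * ‖A.commutatorCLM B‖) := by
        gcongr; exact norm_expIComm_le hB h1.hasCommutator τ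
    _ = |τ| * ‖(𝓕 g : 𝓢(ℝ, ℂ)) τ‖ * ‖A.commutatorCLM B‖ := by ring

/-! ## §4. Headline (registered helper stub) -/

/-- **The bounded calculus of a regular self-adjoint operator is regular, headline form** (all
binders explicit; registered helper stub of `stub_mourreThresholdLAP`): for self-adjoint
`B ∈ C¹(A; H) ∩ 𝒞^{1,1}(A; H)` and every Schwartz `g`, `∫ 𝓕g(τ) e^{iτB} dτ ∈ C¹(A; H) ∩ 𝒞^{1,1}(A; H)`.
[cite: AmreinBoutetdeMonvelGeorgescu1996, Thm. 6.2.5] -/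
theorem expCalculus_regular_of_regular :
    ∀ (K : Type) [NormedAddCommGroup K] [InnerProductSpace ℂ K] [CompleteSpace K]
      (A : Literature.Analysis.UnboundedOperators.OneParameterUnitaryGroup K) (B : K →L[ℂ] K)
      (g : SchwartzMap ℝ ℂ), IsSelfAdjoint B → A.IsOfClassC1 B → A.IsOfClassC11 B →
        A.IsOfClassC1
            (Summit.AtomisticToContinuum.FouriersLaw.Theorems.MourreDissolution.expCalculus B g) ∧
          A.IsOfClassC11
            (Summit.AtomisticToContinuum.FouriersLaw.Theorems.MourreDissolution.expCalculus B g) := by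
  intro K _ _ _ A B g hB h1 h11
  exact ⟨isOfClassC1_expCalculus hB h1 g, isOfClassC11_expCalculus hB h1 h11 g⟩

end Summit.AtomisticToContinuum.FouriersLaw.Theorems.MourreDissolution
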